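import Summits.ABC.ABC.Theorems.IsogenyGlueCongruencePolyDegreeOfBoundedPrimesStubOptimalDatumSemistable
import Literature.NumberTheory.EllipticCurves.PastenSpectralDegreeIsogenyBoundProofs
import Literature.NumberTheory.EllipticCurves.NeronIsogenyScaling

/-!
# The Manin input `M` of crux B is fact-grade: `|c| ≤ 163` at square-free level
# (crux `PolyDegreeOfBoundedPrimes`, stmt-ABC-2046, line `Sketch` v5, rider `maninBound_of_facts`)

Crux B has been calibrated as `B ↔ (A → H ∧ M)` with `H` the polynomial height conjecture and `M`
"every semistable globally minimal curve has a datum with polynomially bounded Manin constant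
`|c|`". This rider closes the book on `M`: modulo four NAMED FACTS of the tree, all known in print —

* `hEd`  : `Literature.NumberTheory.EllipticCurves.edixhoven_int_of_neronLattice_eq_smul_periodLattice`
  (Edixhoven 1991, Prop. 2: the Manin constant of the strong Weil curve is an integer, lattice form);
* `hCes` : the universal closure of `ModularParametrizationData.abs_maninConstant_eq_one_of_isSemistable`
  (Česnavičius 2018, Thm. 1.2: `|c₀| = 1` for the optimal datum of a semistable curve on a globally
  minimal model);
* `h163` : `PastenShimura2024_minimalDegree_le_163_mul` (Mazur 1978, Thm. 1 + Kenku 1982, as used by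
  Pasten 2024, §3 p. 13; the route item `MazurKenkuBound`);
* `hNS`  : `Literature.NumberTheory.EllipticCurves.integral_neronScaling_of_isGloballyMinimal`
  (Silverman ATAEC IV.5.1: a rational multiplier between the Néron lattices of two globally minimal
  models is an integer) —

EVERY globally minimal elliptic `W/ℚ` carrying a datum `D` at a square-free level `N` has a datum
with the SAME newform and `|c| ≤ 163` (so `M` holds with exponent `0`).

Proof. Mazur–Kenku in lattice form (`PastenShimura2024_minimalDegree_le_163_mul_iff`) gives an
integer `k ≠ 0` with `k Λ_f ⊆ Λ_W` and `m := #ker(z ↦ kz : ℂ/Λ_f → ℂ/Λ_W) ≤ 163`, `m ≥ 1`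
(the kernel is finite, `finite_ker_mulQuotientMap`). The class-optimal datum `D₀` lives on a globally
minimal semistable `W₀` (`stub_optimalDatumSemistable`), and `|c₀| = 1` (`hCes`). A finite group is
killed by its order, so `m · k⁻¹ Λ_W ⊆ Λ_f`, whence `(m c₀ / k) Λ_W ⊆ c₀ Λ_f ⊆ Λ_{W₀}`; by Néron
scaling between the globally minimal models `W, W₀` (`hNS`) the rational number `m c₀ / k` is a
(nonzero) integer `j`, so `|k| ≤ |j| |k| = m |c₀| = m ≤ 163`. Finally `D` may be given the Manin
constant `k` (`ModularParametrizationData.exists_datum_c_eq`). No definition, no new named fact;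
supports stmt-ABC-2046.

References: B. Edixhoven, *On the Manin constants of modular elliptic curves* (1991), Prop. 2;
K. Česnavičius, *The Manin constant in the semistable case*, Compositio Math. 154 (2018), Thm. 1.2;
H. Pasten, *Shimura curves and the abc conjecture*, J. Number Theory 254 (2024), §3 p. 13;
J. H. Silverman, *Advanced Topics in the Arithmetic of Elliptic Curves*, GTM 151 (1994), IV.5.1.
-/

noncomputable section

-- single-conjunct summit ABC: the duplicate ABC.ABC is mandated (CONVENTIONS §2)
set_option linter.dupNamespace false

namespace Summit.ABC.ABC.Theorems

open Literature.NumberTheory.EllipticCurves Literature.NumberTheory.EllipticCurves.ModularForms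
  CongruenceSubgroup

/-- **The Manin input `M` is fact-grade: `|c| ≤ 163`.** Granted Edixhoven's Prop. 2 in lattice form
(`hEd`), Česnavičius's theorem (`hCes`: `|c₀| = 1` for the optimal datum of a semistable curve on a
globally minimal model), the Mazur–Kenku bound `deg φ_{D'} ≤ 163 · deg φ_{D_opt}` (`h163`) and the
integrality of the Néron scaling of a rational isogeny between globally minimal models (`hNS`),
every globally minimal elliptic `W/ℚ` with a datum `D` at a square-free level `N` has a datum `D'`
with the same newform, `D'.f = D.f`, and `|c_{D'}| ≤ 163`: Mazur–Kenku in lattice form gives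
`k ∈ ℤ`, `k ≠ 0`, `k Λ_f ⊆ Λ_W` with `m = #ker(z ↦ kz) ≤ 163`; the class-optimal datum `D₀` on a
globally minimal semistable `W₀` has `|c₀| = 1`; `m` kills the kernel, so
`(m c₀ / k) Λ_W ⊆ c₀ Λ_f ⊆ Λ_{W₀}` and Néron scaling makes `m c₀ / k` a nonzero integer, i.e.
`|k| ≤ m ≤ 163`; and `D` may be given the Manin constant `k` (`exists_datum_c_eq`).
[cite: EdixhovenManin1991, Prop. 2] [cite: Cesnavicius2018, Thm. 1.2]
[cite: PastenShimura2024, §3 p. 13] [cite: SilvermanATAEC1994, IV.5.1] -/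
theorem maninBound_of_facts : Literature.NumberTheory.EllipticCurves.edixhoven_int_of_neronLattice_eq_smul_periodLattice → (∀ {W' : WeierstrassCurve ℚ} {N' : ℕ} [NeZero N'] (D' : Literature.NumberTheory.EllipticCurves.ModularForms.ModularParametrizationData W' N'), D'.abs_maninConstant_eq_one_of_isSemistable) → Literature.NumberTheory.EllipticCurves.ModularForms.PastenShimura2024_minimalDegree_le_163_mul → Literature.NumberTheory.EllipticCurves.integral_neronScaling_of_isGloballyMinimal → ∀ (N : ℕ) [NeZero N] (W : WeierstrassCurve ℚ) [W.IsElliptic] [W.IsGloballyMinimal] (D : Literature.NumberTheory.EllipticCurves.ModularForms.ModularParametrizationData W N), Squarefree N → ∃ D' : Literature.NumberTheory.EllipticCurves.ModularForms.ModularParametrizationData W N, D'.f = D.f ∧ |D'.maninConstant| ≤ 163 := by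
  intro hEd hCes h163 hNS N _ W _ _ D hsq
  -- (1) Mazur–Kenku in lattice form: `k ∈ ℤ`, `k ≠ 0`, `k Λ_f ⊆ Λ_W`, `#ker(z ↦ kz) ≤ 163`
  obtain ⟨k, hk, hk0, hcard⟩ := PastenShimura2024_minimalDegree_le_163_mul_iff.mp h163 D
  have hkC : (k : ℂ) ≠ 0 := Int.cast_ne_zero.mpr hk0
  -- the kernel is finite, of order `m ≥ 1`
  haveI := discreteTopology_periodLattice_of_mul_mem D.f hkC hk
  obtain ⟨b, hb⟩ := exists_basis_span_eq_periodLattice D.f D.isNewformOf.1.ne_zero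
  haveI hfin : Finite (mulQuotientMap (periodLattice D.f) D.L.lattice.toAddSubgroup (k : ℂ) hk).ker :=
    finite_ker_mulQuotientMap b hb D.L hk hkC
  set m : ℕ := Nat.card (mulQuotientMap (periodLattice D.f) D.L.lattice.toAddSubgroup (k : ℂ) hk).ker
    with hm
  have hmpos : 0 < m := Nat.card_pos
  -- (2) the class-optimal datum on a globally minimal semistable model; Česnavičius: `|c₀| = 1`
  obtain ⟨W₀, hW₀, hW₀', D₀, hf₀, hss₀, -, -, hmin₀⟩ := stub_optimalDatumSemistable hEd N W D hsq
  haveI := hW₀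
  haveI := hW₀'
  have hc₀ : |D₀.maninConstant| = 1 := hCes D₀ hss₀ hmin₀
  -- (3) `(m c₀ / k) Λ_W ⊆ Λ_{W₀}`: `m` kills the kernel, so `m k⁻¹ Λ_W ⊆ Λ_f`, and `c₀ Λ_f ⊆ Λ_{W₀}`
  set q : ℚ := (m : ℚ) * D₀.c / k with hq_def
  have hq : ∀ w ∈ D.L.lattice, ((q : ℚ) : ℂ) * w ∈ D₀.L.lattice := by
    intro w hw
    set z : ℂ := (k : ℂ)⁻¹ * w with hz_def
    have hkz : (k : ℂ) * z = w := mul_inv_cancel_left₀ hkC w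
    -- the class of `z` lies in the kernel
    have hzker : (z : ℂ ⧸ periodLattice D.f) ∈
        (mulQuotientMap (periodLattice D.f) D.L.lattice.toAddSubgroup (k : ℂ) hk).ker := by
      rw [AddMonoidHom.mem_ker, mulQuotientMap_mk, QuotientAddGroup.eq_zero_iff, hkz]
      exact hw
    -- a finite group is killed by its order
    have hmz0 : m • (z : ℂ ⧸ periodLattice D.f) = 0 := by
      have h := congrArg Subtype.val (card_nsmul_eq_zero' (x := (⟨_, hzker⟩ :
        (mulQuotientMap (periodLattice D.f) D.L.lattice.toAddSubgroup (k : ℂ) hk).ker)))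
      rw [AddSubgroupClass.coe_nsmul, ZeroMemClass.coe_zero, ← hm] at h
      exact h
    have hmz : (m : ℂ) * z ∈ periodLattice D₀.f := by
      rw [hf₀, ← QuotientAddGroup.eq_zero_iff, ← nsmul_eq_mul, QuotientAddGroup.mk_nsmul]
      exact hmz0
    have key := D₀.smul_periodLattice_le _ hmz
    have hqw : ((q : ℚ) : ℂ) * w = (D₀.c : ℂ) * ((m : ℂ) * z) := by
      rw [hq_def, ← hkz]
      push_cast
      field_simp
    rw [hqw]
    exact key
  -- (4) Néron scaling between the globally minimal models `W`, `W₀`: `m c₀ / k = j ∈ ℤ`, so `|k| ≤ m`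
  obtain ⟨j, hj⟩ := hNS W W₀ D.L D₀.L D.isNeronLattice D₀.isNeronLattice q hq
  have hjk : j * k = (m : ℤ) * D₀.c := by
    have hkQ : (k : ℚ) ≠ 0 := Int.cast_ne_zero.mpr hk0
    have h : (j : ℚ) * k = (m : ℚ) * D₀.c := by
      rw [hj, hq_def]
      field_simp
    exact_mod_cast h
  have habs : |j| * |k| = (m : ℤ) := by
    rw [← abs_mul, hjk, abs_mul, Nat.abs_cast, show |D₀.c| = 1 from hc₀, mul_one]
  have hj0 : j ≠ 0 := by
    rintro rfl
    rw [abs_zero, zero_mul] at habs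
    omega
  have hkm : |k| ≤ (m : ℤ) :=
    calc |k| = 1 * |k| := (one_mul _).symm
      _ ≤ |j| * |k| := mul_le_mul_of_nonneg_right (Int.one_le_abs hj0) (abs_nonneg k)
      _ = m := habs
  -- (5) the datum with Manin constant `k`
  obtain ⟨Dk, hfk, -, -, hck⟩ := D.exists_datum_c_eq hk0 hk
  refine ⟨Dk, hfk, ?_⟩
  show |Dk.c| ≤ 163
  rw [hck]
  calc |k| ≤ (m : ℤ) := hkm
    _ ≤ 163 := by exact_mod_cast hcard

end Summit.ABC.ABC.Theorems

end
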